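import Literature.Probability.LatticeModels.HighDimTrivialityWick
import Literature.Probability.LatticeModels.RandomCurrentsProofs
import Literature.Probability.LatticeModels.IsingTransport
import Mathlib.GroupTheory.Perm.Fin
import HarnessLib

/-!
# Newman's Gaussian inequality for Ising correlations (the lower half of Aizenman's inequality), finite volume

Topic `Literature/Probability/LatticeModels`. This file **discharges** the named fact
`aizenman_nPoint_le_pairingSum_finite` of `HighDimTrivialityWick` (Part M there): for the
nearest-neighbour ferromagnetic Ising model in a finite volume `Λ ⊂ ℤ^d` with free boundary
condition, zero field and `β ≥ 0`,

`⟨σ_{x₁} ⋯ σ_{x_{2n}}⟩_{Λ,β} ≤ 𝒢_n[⟨σ_· σ_·⟩_{Λ,β}](x₁,…,x_{2n})`,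

`𝒢_n[S₂]` the Gaussian pairing functional (`pairingSum`: Wick's law with covariance `S₂`). This is
the lower inequality `0 ≤ 𝒢_n[S_β] - S_β(x₁,…,x_{2n})` of the first display of
Aizenman–Duminil-Copin 2021, §6.3 (p. 26 of arXiv:1912.07973), "derived using the switching lemma
in [Aiz82]"; as an inequality for ferromagnetic Ising models it is Newman's Gaussian inequality
(Z. Wahrsch. verw. Gebiete 33 (1975)). Through `pairingLowerBound_of_finite` and
`newman_evenMoment_le_of_pointwise` (tree) it feeds the Gaussian domination of the even moments of
the smeared field used in the triviality theorems (`IsingTrivialityFromDimensionFour`, crit-ising.S13).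

## The printed argument, as formalised

Random-current representation on a finite graph `G` (all PROVED in `RandomCurrentsProofs`):
`⟨σ_A⟩ = Z_A/Z_∅` with `Z_A = ∑_{∂n = A} w_β(n)` (`isingCorr_free_eq_currentSum_div_holds`), the
switching lemma (`currentSum_switching_holds`) and the parity fact that a source is connected to
another source (`Current.exists_source_reachable`).

1. *One switching* (`currentSum_mul_currentSum_empty_le`): for `v ∈ B`,
   `Z_B Z_∅ ≤ ∑_{y ∈ B∖{v}} Z_{B∆{v}∆{y}} Z_{{v}∆{y}}` — in `n₁` (`∂n₁ = B`) the source `v` is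
   connected to some other source `y`, so `1 ≤ ∑_y 𝟙[v ↔ y in n₁+n₂]`, and the switching lemma
   evaluates each `y`-term. Dividing by `Z_∅²`: `⟨σ_B⟩ ≤ ∑_{y ∈ B∖{v}} ⟨σ_vσ_y⟩⟨σ_{B∆{v}∆{y}}⟩`
   (`isingCorr_le_sum_twoPoint_mul`).
2. *Repetitions.* `∏ᵢ σ_{xᵢ} = σ_{oddSupport x}` (sites of odd multiplicity); removing two entries
   `x_p, x_b` changes the odd support by `{x_p} ∆ {x_b}` (`oddSupport_comp_pairRest`). Hence the
   index form of the one-step inequality (`nPoint_le_sum_twoPoint_mul_nPoint`):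
   `⟨∏ σ_{xᵢ}⟩ ≤ ∑_{b ≠ p} ⟨σ_{x_p}σ_{x_b}⟩ ⟨∏_{i ≠ p,b} σ_{xᵢ}⟩` for every `p` (if `x_p` has even
   multiplicity the single term `b` with `x_b = x_p` already suffices).
3. *Induction.* Averaging over `p`, applying the induction hypothesis to the shortened families
   and recognising the first-pair recursion of the pairing functional,
   `𝒢_{k+1}(x) = (2k+2)⁻¹ ∑_p ∑_{b ≠ p} S(x_p,x_b) 𝒢_k(x^{(p,b)})` (`pairingSum_succ`), gives
   `⟨∏ σ_{xᵢ}⟩ ≤ 𝒢_k(x)` (`nPoint_le_pairingSum_univ_free`, every `k`, with equality `1 = 1` at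
   `k = 0`).
4. *Finite volumes of `ℤ^d`.* The free measure in `Λ` only depends on the graph induced on `Λ`
   (`isingExpect_free_map` of `IsingTransport`), whence the named fact
   (`aizenman_nPoint_le_pairingSum_finite_holds`).

## Design

* The indices other than an ordered pair are enumerated in `Equiv.Perm.decomposeFin`
  coordinates: `pairPerm p q = decomposeFin⁻¹(p, decomposeFin⁻¹(q, 1))` is a permutation with
  `pairPerm p q 0 = p`, `b(p,q) := pairPerm p q 1 = swap 0 p q.succ` (all indices `≠ p` as `q`
  varies), and `pairRest p q j = pairPerm p q (j+2)`. This makes the recursion `pairingSum_succ` a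
  direct reindexing of the sum over orderings (`decomposeFin` twice), with no appeal to the
  symmetry of `S₂` and no order-embeddings.
* Everything up to Part IV is stated for an arbitrary finite simple graph (the setting of
  `RandomCurrents`); only Part V specialises to `zdGraph d`.

## References

* M. Aizenman, H. Duminil-Copin, Ann. of Math. 194 (2021), arXiv:1912.07973, §6.3 p. 26 (first
  display) and Lemma 3.3 (switching) [AizenmanDuminilCopinAnnals2021].
* M. Aizenman, Comm. Math. Phys. 86 (1982) 1–48, Lemma 3.2 and §12 [Aizenman1982] (paywalled, not
  consulted; cited through ADC 2021 and Duminil-Copin 2016).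
* H. Duminil-Copin, *Random currents expansion of the Ising model*, arXiv:1607.06933, Lemma 2.2
  [DuminilCopin2016].
* C. M. Newman, *Inequalities for Ising models and field theories which obey the Lee–Yang
  theorem*, Comm. Math. Phys. 41 (1975); *Gaussian correlation inequalities for ferromagnets*,
  Z. Wahrsch. verw. Gebiete 33 (1975) 75–93 (the inequality; not consulted).
* R. B. Griffiths, C. A. Hurst, S. Sherman, J. Math. Phys. 11 (1970) 790 [GriffithsHurstSherman1970].

## Mathlib

`Equiv.Perm.decomposeFin` and its `simp` lemmas (`Mathlib.GroupTheory.Perm.Fin`), `Equiv.sum_comp`,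
`Fintype.sum_prod_type`, `Finset.sum_fiberwise_of_maps_to`, `Summable.tsum_finsetSum`,
`Summable.tsum_le_tsum`. Mathlib has no Ising model / random currents / Wick pairings.
-/

noncomputable section

open MeasureTheory Finset
open scoped Nat symmDiff

namespace Literature.Probability.LatticeModels

/-! ### Part I. Removing an ordered pair of indices; the recursion of the pairing functional -/

/-- The permutation of `Fin (m+2)` with `τ 0 = p`, `τ 1 = swap 0 p q.succ` and the remaining
indices listed by `τ (j+2)`, i.e. `decomposeFin⁻¹ (p, decomposeFin⁻¹ (q, 1))`. [folklore] -/
def pairPerm {m : ℕ} (p : Fin (m + 2)) (q : Fin (m + 1)) : Equiv.Perm (Fin (m + 2)) :=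
  Equiv.Perm.decomposeFin.symm (p, Equiv.Perm.decomposeFin.symm (q, 1))

/-- The enumeration `j ↦ pairPerm p q (j+2)` of the indices other than `p` and
`pairPerm p q 1`. [folklore] -/
def pairRest {m : ℕ} (p : Fin (m + 2)) (q : Fin (m + 1)) (j : Fin m) : Fin (m + 2) :=
  pairPerm p q j.succ.succ

/-- `pairPerm p q 0 = p`. [folklore] -/
theorem pairPerm_zero {m : ℕ} (p : Fin (m + 2)) (q : Fin (m + 1)) : pairPerm p q 0 = p := by
  simp [pairPerm]

/-- `pairPerm p q 1 = swap 0 p q.succ`. [folklore] -/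
theorem pairPerm_one {m : ℕ} (p : Fin (m + 2)) (q : Fin (m + 1)) :
    pairPerm p q 1 = Equiv.swap 0 p q.succ := by
  rw [pairPerm, ← Fin.succ_zero_eq_one, Equiv.Perm.decomposeFin_symm_apply_succ,
    Equiv.Perm.decomposeFin_symm_apply_zero]

/-- `pairPerm p q 1 ≠ p`. [folklore] -/
theorem pairPerm_one_ne {m : ℕ} (p : Fin (m + 2)) (q : Fin (m + 1)) : pairPerm p q 1 ≠ p := by
  intro h
  have h' : pairPerm p q 1 = pairPerm p q 0 := h.trans (pairPerm_zero p q).symm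
  exact absurd ((pairPerm p q).injective h') Fin.zero_lt_one.ne'

/-- The general element of the fibre: `decomposeFin⁻¹ (p, decomposeFin⁻¹ (q, ρ))` sends `j+2` to
`pairRest p q (ρ j)`. [folklore] -/
theorem decomposeFin_symm_symm_succ_succ {m : ℕ} (p : Fin (m + 2)) (q : Fin (m + 1))
    (ρ : Equiv.Perm (Fin m)) (j : Fin m) :
    Equiv.Perm.decomposeFin.symm (p, Equiv.Perm.decomposeFin.symm (q, ρ)) j.succ.succ =
      pairRest p q (ρ j) := by
  simp [pairRest, pairPerm, Equiv.Perm.decomposeFin_symm_apply_succ]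

/-- `decomposeFin⁻¹ (p, decomposeFin⁻¹ (q, ρ))` sends `0` to `p`. [folklore] -/
theorem decomposeFin_symm_symm_zero {m : ℕ} (p : Fin (m + 2)) (q : Fin (m + 1))
    (ρ : Equiv.Perm (Fin m)) :
    Equiv.Perm.decomposeFin.symm (p, Equiv.Perm.decomposeFin.symm (q, ρ)) 0 = p := by
  simp

/-- `decomposeFin⁻¹ (p, decomposeFin⁻¹ (q, ρ))` sends `1` to `pairPerm p q 1`. [folklore] -/
theorem decomposeFin_symm_symm_one {m : ℕ} (p : Fin (m + 2)) (q : Fin (m + 1))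
    (ρ : Equiv.Perm (Fin m)) :
    Equiv.Perm.decomposeFin.symm (p, Equiv.Perm.decomposeFin.symm (q, ρ)) 1 = pairPerm p q 1 := by
  rw [pairPerm_one, ← Fin.succ_zero_eq_one, Equiv.Perm.decomposeFin_symm_apply_succ,
    Equiv.Perm.decomposeFin_symm_apply_zero]

/-- `pairRest p q` is injective. [folklore] -/
theorem pairRest_injective {m : ℕ} (p : Fin (m + 2)) (q : Fin (m + 1)) :
    Function.Injective (pairRest p q) := fun i j h => by
  simpa using (pairPerm p q).injective h

/-- `pairIdx (k+1) (0, c) = c`. [folklore] -/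
theorem pairIdx_zero {k : ℕ} (c : Fin 2) : (pairIdx (k + 1) (0, c) : Fin (2 * (k + 1))) = ⟨c, by omega⟩ := by
  ext; simp [pairIdx_apply_val]

/-- `pairIdx (k+1) (j+1, c) = pairIdx k (j, c) + 2`. [folklore] -/
theorem pairIdx_succ {k : ℕ} (j : Fin k) (c : Fin 2) :
    (pairIdx (k + 1) (j.succ, c) : Fin (2 * (k + 1))) = (pairIdx k (j, c)).succ.succ := by
  ext; simp [pairIdx_apply_val]; omega

/-- **Recursion of the Gaussian pairing functional** (first-pair decomposition of the average over
orderings): for `x : Fin (2k+2) → α`,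
`𝒢_{k+1}[S](x) = (2k+2)⁻¹ ∑_p ∑_q S(x_p, x_{b(p,q)}) 𝒢_k[S](x^{(p,q)})`, where `b(p,q) = pairPerm p q 1`
runs over the indices `≠ p` as `q` varies and `x^{(p,q)} = x ∘ pairRest p q` lists the remaining
points. (With the sum over pairings instead of orderings this is the familiar
`𝒢_{k+1}(x) = ∑_{b ≠ a} S(x_a,x_b) 𝒢_k(x^{(a,b)})`.) [folklore] -/
theorem pairingSum_succ {α : Type*} (S₂ : α → α → ℝ) (k : ℕ) (x : Fin (2 * (k + 1)) → α) :
    pairingSum S₂ (k + 1) x = ((2 * (k + 1) : ℕ) : ℝ)⁻¹ *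
      ∑ p : Fin (2 * k + 2), ∑ q : Fin (2 * k + 1),
        S₂ (x p) (x (pairPerm p q 1)) * pairingSum S₂ k (x ∘ pairRest p q) := by
  -- the summand of the raw permutation sum
  set F : Equiv.Perm (Fin (2 * (k + 1))) → ℝ := fun τ =>
    ∏ j : Fin (k + 1), S₂ (x (τ (pairIdx (k + 1) (j, 0)))) (x (τ (pairIdx (k + 1) (j, 1)))) with hF
  have hFval : ∀ (p : Fin (2 * k + 2)) (q : Fin (2 * k + 1)) (ρ : Equiv.Perm (Fin (2 * k))),
      F (Equiv.Perm.decomposeFin.symm (p, Equiv.Perm.decomposeFin.symm (q, ρ))) =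
        S₂ (x p) (x (pairPerm p q 1)) *
          ∏ j : Fin k, S₂ ((x ∘ pairRest p q) (ρ (pairIdx k (j, 0))))
            ((x ∘ pairRest p q) (ρ (pairIdx k (j, 1)))) := by
    intro p q ρ
    rw [hF]
    dsimp only
    rw [Fin.prod_univ_succ]
    have e0 : x (Equiv.Perm.decomposeFin.symm (p, Equiv.Perm.decomposeFin.symm (q, ρ))
        (pairIdx (k + 1) (0, 0))) = x p := by
      rw [pairIdx_zero]
      exact congrArg x (decomposeFin_symm_symm_zero p q ρ)
    have e1 : x (Equiv.Perm.decomposeFin.symm (p, Equiv.Perm.decomposeFin.symm (q, ρ))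
        (pairIdx (k + 1) (0, 1))) = x (pairPerm p q 1) := by
      rw [pairIdx_zero]
      exact congrArg x (decomposeFin_symm_symm_one p q ρ)
    rw [e0, e1]
    refine congrArg₂ (· * ·) rfl (Finset.prod_congr rfl fun j _ => ?_)
    simp only [pairIdx_succ, decomposeFin_symm_symm_succ_succ, Function.comp]
  -- the raw sums
  have raw : ∑ τ, F τ =
      ∑ p : Fin (2 * k + 2), ∑ q : Fin (2 * k + 1), S₂ (x p) (x (pairPerm p q 1)) *
        ∑ ρ : Equiv.Perm (Fin (2 * k)),
          ∏ j : Fin k, S₂ ((x ∘ pairRest p q) (ρ (pairIdx k (j, 0))))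
            ((x ∘ pairRest p q) (ρ (pairIdx k (j, 1)))) := by
    calc ∑ τ, F τ
        = ∑ pr : Fin (2 * k + 2) × Equiv.Perm (Fin (2 * k + 1)), F (Equiv.Perm.decomposeFin.symm pr) :=
          (Equiv.sum_comp Equiv.Perm.decomposeFin.symm F).symm
      _ = ∑ p : Fin (2 * k + 2), ∑ e : Equiv.Perm (Fin (2 * k + 1)),
            F (Equiv.Perm.decomposeFin.symm (p, e)) := Fintype.sum_prod_type _
      _ = ∑ p : Fin (2 * k + 2), ∑ pr : Fin (2 * k + 1) × Equiv.Perm (Fin (2 * k)),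
            F (Equiv.Perm.decomposeFin.symm (p, Equiv.Perm.decomposeFin.symm pr)) :=
          Finset.sum_congr rfl fun p _ =>
            (Equiv.sum_comp Equiv.Perm.decomposeFin.symm
              (fun e => F (Equiv.Perm.decomposeFin.symm (p, e)))).symm
      _ = ∑ p : Fin (2 * k + 2), ∑ q : Fin (2 * k + 1), ∑ ρ : Equiv.Perm (Fin (2 * k)),
            F (Equiv.Perm.decomposeFin.symm (p, Equiv.Perm.decomposeFin.symm (q, ρ))) :=
          Finset.sum_congr rfl fun p _ => Fintype.sum_prod_type _
      _ = _ := by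
          refine Finset.sum_congr rfl fun p _ => Finset.sum_congr rfl fun q _ => ?_
          rw [Finset.mul_sum]
          exact Finset.sum_congr rfl fun ρ _ => hFval p q ρ
  have hdef : pairingSum S₂ (k + 1) x = ((2 : ℝ) ^ (k + 1) * ((k + 1)! : ℕ))⁻¹ * ∑ τ, F τ := rfl
  rw [hdef, raw, Finset.mul_sum, Finset.mul_sum]
  refine Finset.sum_congr rfl fun p _ => ?_
  rw [Finset.mul_sum, Finset.mul_sum]
  refine Finset.sum_congr rfl fun q _ => ?_
  have h1 : ((2 : ℝ) ^ (k + 1) * ((k + 1)! : ℕ)) = ((2 * (k + 1) : ℕ) : ℝ) * (2 ^ k * (k ! : ℕ)) := by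
    push_cast [Nat.factorial_succ, pow_succ]
    ring
  rw [h1, pairingSum]
  have h2 : ((2 * (k + 1) : ℕ) : ℝ) ≠ 0 := by positivity
  have h3 : (2 : ℝ) ^ k * (k ! : ℕ) ≠ 0 := by positivity
  field_simp

section Currents

variable {V : Type*} [Fintype V] [DecidableEq V] (G : SimpleGraph V) [DecidableRel G.Adj]

/-! ### Part II. The Gaussian step: one switching -/

/-- **One switching: the source `v` is paired with some other source.** For `β ≥ 0`, a set of
sources `B ∋ v` on the finite graph `G`,
`Z_B · Z_∅ ≤ ∑_{y ∈ B ∖ {v}} Z_{B ∆ {v} ∆ {y}} · Z_{{v} ∆ {y}}` (`Z_A = ∑_{∂n = A} w_β(n)`):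
in a current `n₁` with `∂n₁ = B` the source `v` is connected to another source `y`
(`Current.exists_source_reachable`, the handshake parity), hence `1 ≤ ∑_y 𝟙[v ↔ y in n₁ + n₂]`,
and for each `y` the switching lemma turns `∑ 𝟙[∂n₁ = B, ∂n₂ = ∅] w w 𝟙[v ↔ y]` into
`Z_{B ∆ {v}∆{y}} Z_{{v}∆{y}}` (Aizenman 1982, the Gaussian-type inequality via Lemma 3.2; the
first display of Aizenman–Duminil-Copin 2021 §6.3, lower half, is its iteration).
[cite: AizenmanDuminilCopinAnnals2021, arXiv:1912.07973 §6.3, first display, lower inequality (p. 26)] -/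
theorem currentSum_mul_currentSum_empty_le {β : ℝ} (hβ : 0 ≤ β) (B : Finset V) {v : V}
    (hv : v ∈ B) :
    currentSum G β B * currentSum G β ∅ ≤
      ∑ y ∈ B.erase v, currentSum G β (B ∆ ({v} ∆ {y})) * currentSum G β ({v} ∆ {y}) := by
  classical
  -- each term of the right-hand side as a series over pairs of currents (switching lemma)
  have hterm : ∀ y : V, currentSum G β (B ∆ ({v} ∆ {y})) * currentSum G β ({v} ∆ {y}) =
      ∑' p : Current G × Current G, pairWeight G β B ∅ p * (tracedConn G v y).indicator 1 p := by
    intro y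
    have hsw := currentSum_switching_holds G β (B ∆ ({v} ∆ {y})) v y (fun _ => 1)
      ⟨1, fun n => by simp⟩
    simp only [mul_one] at hsw
    rw [symmDiff_symmDiff_cancel_right, (hasSum_pairWeight_holds G β _ _).tsum_eq] at hsw
    exact hsw
  -- the left-hand side as a series
  rw [← (hasSum_pairWeight_holds G β B ∅).tsum_eq]
  simp_rw [hterm]
  have hsum : ∀ y ∈ B.erase v, Summable fun p : Current G × Current G =>
      pairWeight G β B ∅ p * (tracedConn G v y).indicator 1 p := fun y _ =>
    summable_pairWeight_mul G β B ∅ (C := 1) fun p => by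
      rw [Set.indicator_apply]; split_ifs <;> simp
  rw [← Summable.tsum_finsetSum hsum]
  refine ((hasSum_pairWeight_holds G β B ∅).summable).tsum_le_tsum (fun p => ?_)
    (summable_sum hsum)
  -- termwise: parity
  by_cases hp : p.1.sources = B ∧ p.2.sources = ∅
  · obtain ⟨y, hyB, hyv, hreach⟩ := Current.exists_source_reachable G p.1 (x := v) (hp.1 ▸ hv)
    have hy : y ∈ B.erase v := Finset.mem_erase.mpr ⟨hyv, hp.1 ▸ hyB⟩
    have hind : (tracedConn G v y).indicator (1 : Current G × Current G → ℝ) p = 1 := by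
      rw [Set.indicator_of_mem]
      · rfl
      · rw [mem_tracedConn_iff, Current.traced_add]
        exact hreach.mono (Percolation.openGraph_mono Set.subset_union_left)
    calc pairWeight G β B ∅ p = pairWeight G β B ∅ p * (tracedConn G v y).indicator 1 p := by
          rw [hind, mul_one]
      _ ≤ ∑ y ∈ B.erase v, pairWeight G β B ∅ p * (tracedConn G v y).indicator 1 p :=
          Finset.single_le_sum (f := fun y => pairWeight G β B ∅ p * (tracedConn G v y).indicator 1 p)
            (fun y _ => mul_nonneg (pairWeight_nonneg G hβ B ∅ p)
              (by rw [Set.indicator_apply]; split_ifs <;> simp)) hy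
  · have h0 : pairWeight G β B ∅ p = 0 := by
      unfold pairWeight; rw [if_neg hp]
    rw [h0]
    exact Finset.sum_nonneg fun y _ => by rw [zero_mul]



/-- Griffiths' first inequality for the free zero-field state on a finite graph, from the
random-current representation: `⟨σ_A⟩ = Z_A / Z_∅ ≥ 0`. [cite: GriffithsHurstSherman1970] -/
theorem isingCorr_univ_free_nonneg {β : ℝ} (hβ : 0 ≤ β) (A : Finset V) :
    0 ≤ isingCorr G univ β 0 .free A := by
  rw [isingCorr_free_eq_currentSum_div_holds G β A]
  exact div_nonneg (currentSum_nonneg G hβ A) (currentSum_nonneg G hβ ∅)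

/-- **The Gaussian step** (Newman 1975; Aizenman 1982): for the free zero-field Ising model on a
finite graph, `β ≥ 0`, a set `B ∋ v`,
`⟨σ_B⟩ ≤ ∑_{y ∈ B ∖ {v}} ⟨σ_v σ_y⟩ ⟨σ_{B ∆ {v} ∆ {y}}⟩`.
[cite: AizenmanDuminilCopinAnnals2021, arXiv:1912.07973 §6.3, first display, lower inequality (p. 26)] -/
theorem isingCorr_le_sum_twoPoint_mul {β : ℝ} (hβ : 0 ≤ β) (B : Finset V) {v : V} (hv : v ∈ B) :
    isingCorr G univ β 0 .free B ≤
      ∑ y ∈ B.erase v, isingTwoPoint G univ β 0 .free v y *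
        isingCorr G univ β 0 .free (B ∆ ({v} ∆ {y})) := by
  have hZ := currentSum_empty_pos' G β
  have key := currentSum_mul_currentSum_empty_le G hβ B hv
  rw [isingCorr_free_eq_currentSum_div_holds G β B]
  simp_rw [isingCorr_free_eq_currentSum_div_holds G β, isingTwoPoint_free_eq_currentSum_div_holds G β]
  have e : ∀ y : V, currentSum G β ({v} ∆ {y}) / currentSum G β ∅ *
      (currentSum G β (B ∆ ({v} ∆ {y})) / currentSum G β ∅) =
      currentSum G β (B ∆ ({v} ∆ {y})) * currentSum G β ({v} ∆ {y}) / (currentSum G β ∅) ^ 2 := by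
    intro y; field_simp
  simp_rw [e, ← Finset.sum_div]
  rw [div_le_div_iff₀ hZ (pow_pos hZ 2)]
  calc currentSum G β B * currentSum G β ∅ ^ 2
      = currentSum G β B * currentSum G β ∅ * currentSum G β ∅ := by ring
    _ ≤ (∑ y ∈ B.erase v, currentSum G β (B ∆ ({v} ∆ {y})) * currentSum G β ({v} ∆ {y})) *
          currentSum G β ∅ := mul_le_mul_of_nonneg_right key hZ.le

/-! ### Part III. Spin monomials with repetitions: the odd support -/

omit [DecidableRel G.Adj] in
/-- The set of vertices occurring an odd number of times in the family `x`. [folklore] -/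
def oddSupport {m : ℕ} (x : Fin m → V) : Finset V :=
  univ.filter fun v => Odd (univ.filter fun i => x i = v).card

omit [DecidableRel G.Adj] in
/-- `∏ᵢ σ_{xᵢ} = σ_{oddSupport x}` (`σ_v² = 1`). [cite: FriedliVelenik2017, §3.6.1] -/
theorem prod_spinAt_eq_spinProduct_oddSupport {m : ℕ} (x : Fin m → V) (σ : SpinConfig V) :
    ∏ i, spinAt (x i) σ = spinProduct (oddSupport x) σ := by
  rw [← Finset.prod_fiberwise_of_maps_to (s := univ) (t := univ) (g := x) fun i _ => mem_univ _]
  rw [oddSupport, spinProduct, Finset.prod_filter]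
  refine Finset.prod_congr rfl fun v _ => ?_
  rw [Finset.prod_congr rfl fun i hi => by rw [(Finset.mem_filter.mp hi).2], Finset.prod_const,
    spinAt_pow_eq_ite]

omit [DecidableRel G.Adj] in
/-- Relabelling the family by a permutation does not change the odd support. [folklore] -/
theorem oddSupport_comp_perm {m : ℕ} (x : Fin m → V) (τ : Equiv.Perm (Fin m)) :
    oddSupport (x ∘ τ) = oddSupport x := by
  ext v
  simp only [oddSupport, Finset.mem_filter, Finset.mem_univ, true_and, Function.comp]
  have hc : (univ.filter fun i => x (τ i) = v).card = (univ.filter fun i => x i = v).card := by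
    refine Finset.card_bij (fun i _ => τ i) (fun i hi => ?_) (fun i _ j _ h => τ.injective h)
      fun j hj => ⟨τ.symm j, ?_, τ.apply_symm_apply j⟩
    · simpa using hi
    · simpa using hj
  rw [hc]

omit [DecidableRel G.Adj] in
/-- Prepending a point flips its membership in the odd support:
`oddSupport (a :: y) = oddSupport y ∆ {a}`. [folklore] -/
theorem oddSupport_cons {m : ℕ} (a : V) (y : Fin m → V) :
    oddSupport (Fin.cons a y : Fin (m + 1) → V) = oddSupport y ∆ {a} := by
  ext v
  simp only [oddSupport, Finset.mem_filter, Finset.mem_univ, true_and, Finset.mem_symmDiff,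
    Finset.mem_singleton]
  have hc : (univ.filter fun i : Fin (m + 1) => (Fin.cons a y : Fin (m + 1) → V) i = v).card =
      (univ.filter fun i : Fin m => y i = v).card + if a = v then 1 else 0 := by
    rw [Finset.card_filter, Finset.card_filter, Fin.sum_univ_succ]
    simp only [Fin.cons_zero, Fin.cons_succ]
    ring
  rw [hc]
  by_cases hav : a = v
  · subst hav
    simp only [if_true, Nat.odd_add_one]
    tauto
  · have hva : ¬v = a := fun h => hav h.symm
    simp only [hav, if_false, add_zero]
    tauto

end Currents

/-! ### Part IV. The Gaussian inequality on a finite graph -/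

section FiniteGraph

variable {V : Type*} [Fintype V] [DecidableEq V] (G : SimpleGraph V) [DecidableRel G.Adj]

/-- `n`-point functions of the free zero-field state on a finite graph are set correlations of the
odd support. [cite: FriedliVelenik2017, §3.6.1] -/
theorem nPoint_univ_free_eq_isingCorr (β : ℝ) {m : ℕ} (x : Fin m → V) :
    nPoint (isingMeasure G univ β 0 .free) spinAt x =
      isingCorr G univ β 0 .free (oddSupport x) := by
  simp only [nPoint, prod_spinAt_eq_spinProduct_oddSupport]
  rfl

/-- Two-point functions of the free zero-field state on a finite graph are non-negative
(Griffiths' first inequality, via random currents). [cite: GriffithsHurstSherman1970] -/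
theorem twoPoint_univ_free_nonneg {β : ℝ} (hβ : 0 ≤ β) (u w : V) :
    0 ≤ twoPoint (isingMeasure G univ β 0 .free) spinAt u w := by
  change 0 ≤ isingTwoPoint G univ β 0 .free u w
  rw [isingTwoPoint_free_eq_currentSum_div_holds G β u w]
  exact div_nonneg (currentSum_nonneg G hβ _) (currentSum_nonneg G hβ ∅)

/-- `n`-point functions of the free zero-field state on a finite graph are non-negative
(Griffiths' first inequality). [cite: GriffithsHurstSherman1970] -/
theorem nPoint_univ_free_nonneg {β : ℝ} (hβ : 0 ≤ β) {m : ℕ} (x : Fin m → V) :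
    0 ≤ nPoint (isingMeasure G univ β 0 .free) spinAt x := by
  rw [nPoint_univ_free_eq_isingCorr]
  exact isingCorr_univ_free_nonneg G hβ _

omit [Fintype V] [DecidableEq V] [DecidableRel G.Adj] in
/-- The diagonal two-point function is `1` (`σ_u² = 1`). [folklore] -/
theorem twoPoint_spinAt_self (μ : Measure (SpinConfig V)) [IsProbabilityMeasure μ] (u : V) :
    twoPoint μ spinAt u u = 1 := by
  simp [twoPoint]

omit [Fintype V] [DecidableEq V] [DecidableRel G.Adj] in
/-- Relabelling by the permutation `pairPerm p q` lists `x_p`, `x_{b(p,q)}` and then the remaining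
points `x ∘ pairRest p q`. [folklore] -/
theorem comp_pairPerm_eq_cons {m : ℕ} (x : Fin (m + 2) → V) (p : Fin (m + 2)) (q : Fin (m + 1)) :
    x ∘ (pairPerm p q) = (Fin.cons (x p) (Fin.cons (x (pairPerm p q 1)) (x ∘ pairRest p q)) :
      Fin (m + 2) → V) := by
  funext i
  refine Fin.cases ?_ (fun i' => ?_) i
  · simp [pairPerm_zero]
  · refine Fin.cases ?_ (fun j => ?_) i'
    · rfl
    · rfl

omit [DecidableRel G.Adj] in
/-- Removing the two indices `p`, `b(p,q)` changes the odd support by `{x_p} ∆ {x_b}`. [folklore] -/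
theorem oddSupport_comp_pairRest {m : ℕ} (x : Fin (m + 2) → V) (p : Fin (m + 2)) (q : Fin (m + 1)) :
    oddSupport (x ∘ pairRest p q) = oddSupport x ∆ ({x p} ∆ {x (pairPerm p q 1)}) := by
  have h := oddSupport_comp_perm x (pairPerm p q)
  rw [comp_pairPerm_eq_cons, oddSupport_cons, oddSupport_cons] at h
  rw [← h, symmDiff_assoc, symmDiff_symmDiff_cancel_left, symmDiff_symmDiff_cancel_right]

omit [Fintype V] [DecidableEq V] [DecidableRel G.Adj] in
/-- Every index other than `p` is `b(p, q) = pairPerm p q 1` for some `q`. [folklore] -/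
theorem exists_pairPerm_one_eq {m : ℕ} (p : Fin (m + 2)) {i : Fin (m + 2)} (hi : i ≠ p) :
    ∃ q : Fin (m + 1), pairPerm p q 1 = i := by
  have h0 : Equiv.swap 0 p i ≠ 0 := by
    intro h
    have : i = p := by
      have := congrArg (Equiv.swap 0 p) h
      rwa [Equiv.swap_apply_self, Equiv.swap_apply_left] at this
    exact hi this
  refine ⟨(Equiv.swap 0 p i).pred h0, ?_⟩
  rw [pairPerm_one, Fin.succ_pred, Equiv.swap_apply_self]

/-- **The one-step inequality in index form.** For the free zero-field state on a finite graph,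
`β ≥ 0`, `x : Fin (2k+2) → V` and every index `p`,
`⟨∏ σ_{xᵢ}⟩ ≤ ∑_q ⟨σ_{x_p} σ_{x_{b(p,q)}}⟩ ⟨∏_{i ∉ {p, b(p,q)}} σ_{xᵢ}⟩`, the sum running over the
indices `b(p,q) ≠ p` (Newman 1975; Aizenman 1982; from `isingCorr_le_sum_twoPoint_mul` when `x_p`
occurs an odd number of times, and trivially — the term `b` with `x_b = x_p` alone — otherwise).
[cite: AizenmanDuminilCopinAnnals2021, arXiv:1912.07973 §6.3, first display, lower inequality (p. 26)] -/
theorem nPoint_le_sum_twoPoint_mul_nPoint {β : ℝ} (hβ : 0 ≤ β) {k : ℕ} (x : Fin (2 * k + 2) → V)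
    (p : Fin (2 * k + 2)) :
    nPoint (isingMeasure G univ β 0 .free) spinAt x ≤
      ∑ q : Fin (2 * k + 1), twoPoint (isingMeasure G univ β 0 .free) spinAt (x p) (x (pairPerm p q 1)) *
        nPoint (isingMeasure G univ β 0 .free) spinAt (x ∘ pairRest p q) := by
  set μ := isingMeasure G univ β 0 .free with hμ
  set B := oddSupport x with hB
  set T : Fin (2 * k + 1) → ℝ := fun q =>
    twoPoint μ spinAt (x p) (x (pairPerm p q 1)) * nPoint μ spinAt (x ∘ pairRest p q) with hT
  have hT0 : ∀ q, 0 ≤ T q := fun q =>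
    mul_nonneg (twoPoint_univ_free_nonneg G hβ _ _) (nPoint_univ_free_nonneg G hβ _)
  -- the value of the `q`-term only depends on `y = x_{b(p,q)}`
  have hTval : ∀ q, T q = isingTwoPoint G univ β 0 .free (x p) (x (pairPerm p q 1)) *
      isingCorr G univ β 0 .free (B ∆ ({x p} ∆ {x (pairPerm p q 1)})) := by
    intro q
    rw [hT]
    dsimp only
    rw [nPoint_univ_free_eq_isingCorr, oddSupport_comp_pairRest]
    rfl
  change nPoint μ spinAt x ≤ ∑ q, T q
  by_cases hp : x p ∈ B
  · -- `x_p` is a source: the Gaussian step, then regroup the values `y` by indices `q`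
    have step := isingCorr_le_sum_twoPoint_mul G hβ B hp
    rw [nPoint_univ_free_eq_isingCorr, ← hB]
    refine step.trans ?_
    -- regroup the sum over `q` according to the value `y = x_{b(p,q)}`
    rw [← Finset.sum_fiberwise_of_maps_to (s := (univ : Finset (Fin (2 * k + 1))))
      (t := (univ : Finset V)) (g := fun q => x (pairPerm p q 1)) fun q _ => mem_univ _]
    refine (Finset.sum_le_sum_of_subset_of_nonneg (Finset.subset_univ (B.erase (x p)))
      (fun y _ _ => Finset.sum_nonneg fun q _ => hT0 q)).trans' ?_
    refine Finset.sum_le_sum fun y hy => ?_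
    obtain ⟨hyp, hyB⟩ := Finset.mem_erase.mp hy
    -- some index `b ≠ p` carries the value `y`
    obtain ⟨i, hi⟩ : ∃ i, x i = y := by
      have hodd : Odd (univ.filter fun i => x i = y).card := by
        rw [hB] at hyB
        simpa [oddSupport] using hyB
      have hne : (univ.filter fun i => x i = y).Nonempty := by
        rw [← Finset.card_pos]
        exact hodd.pos
      obtain ⟨i, hi⟩ := hne
      exact ⟨i, (Finset.mem_filter.mp hi).2⟩
    have hip : i ≠ p := fun h => hyp (by rw [← hi, h])
    obtain ⟨q₀, hq₀⟩ := exists_pairPerm_one_eq p hip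
    have hq₀mem : q₀ ∈ univ.filter fun q => x (pairPerm p q 1) = y :=
      Finset.mem_filter.mpr ⟨mem_univ _, by rw [hq₀, hi]⟩
    calc isingTwoPoint G univ β 0 .free (x p) y * isingCorr G univ β 0 .free (B ∆ ({x p} ∆ {y}))
        = T q₀ := by rw [hTval q₀, hq₀, hi]
      _ ≤ ∑ q ∈ univ.filter (fun q => x (pairPerm p q 1) = y), T q :=
          Finset.single_le_sum (fun q _ => hT0 q) hq₀mem
  · -- `x_p` occurs an even number of times: another index `b` has `x_b = x_p`, and its term is `⟨∏ σ⟩`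
    have heven : ¬Odd (univ.filter fun i => x i = x p).card := by
      have hp' := hp
      rw [hB] at hp'
      simpa [oddSupport] using hp'
    have hpmem : p ∈ univ.filter fun i => x i = x p := Finset.mem_filter.mpr ⟨mem_univ _, rfl⟩
    have hcard : 1 < (univ.filter fun i => x i = x p).card := by
      have h1 : 1 ≤ (univ.filter fun i => x i = x p).card := Finset.card_pos.mpr ⟨p, hpmem⟩
      rcases h1.eq_or_lt with h | h
      · exact absurd (h ▸ odd_one) heven
      · exact h
    obtain ⟨i, hi, hip⟩ := Finset.exists_mem_ne hcard p
    have hxi : x i = x p := (Finset.mem_filter.mp hi).2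
    obtain ⟨q₀, hq₀⟩ := exists_pairPerm_one_eq p hip
    calc nPoint μ spinAt x = T q₀ := by
          rw [hTval q₀, hq₀, hxi, symmDiff_self, symmDiff_bot, nPoint_univ_free_eq_isingCorr, ← hB]
          change _ = twoPoint μ spinAt (x p) (x p) * _
          rw [twoPoint_spinAt_self, one_mul]
      _ ≤ ∑ q, T q := Finset.single_le_sum (fun q _ => hT0 q) (mem_univ q₀)

/-- **Newman's Gaussian inequality / the lower half of Aizenman's inequality, finite graphs.**
For the free zero-field Ising model on a finite graph `G` at `β ≥ 0` and any family of `2k`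
vertices `x` (repetitions allowed),
`⟨σ_{x₁} ⋯ σ_{x_{2k}}⟩ ≤ 𝒢_k[⟨σ_· σ_·⟩](x₁,…,x_{2k})`, the Gaussian pairing functional of the
two-point function (Newman, Z. Wahrsch. 33 (1975); Aizenman 1982 via the switching lemma; the
lower inequality `0 ≤ 𝒢_n[S] - S_{2n}` of the first display of Aizenman–Duminil-Copin 2021,
§6.3, p. 26). Proof: average the one-step inequality over the distinguished index `p`, apply
the induction hypothesis to the families with two points removed, and recognise the recursion
`pairingSum_succ` of the pairing functional. [cite: AizenmanDuminilCopinAnnals2021, arXiv:1912.07973 §6.3, first display, lower inequality (p. 26)] -/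
theorem nPoint_le_pairingSum_univ_free {β : ℝ} (hβ : 0 ≤ β) (k : ℕ) (x : Fin (2 * k) → V) :
    nPoint (isingMeasure G univ β 0 .free) spinAt x ≤
      pairingSum (twoPoint (isingMeasure G univ β 0 .free) spinAt) k x := by
  induction k with
  | zero =>
    have h1 : nPoint (isingMeasure G univ β 0 .free) spinAt x = 1 := by
      simp [nPoint]
    have h2 : pairingSum (twoPoint (isingMeasure G univ β 0 .free) spinAt) 0 x = 1 := by
      simp [pairingSum]
    rw [h1, h2]
  | succ k ih =>
    set μ := isingMeasure G univ β 0 .free with hμ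
    have hpos : (0 : ℝ) < ((2 * (k + 1) : ℕ) : ℝ) := by positivity
    -- sum of the one-step inequalities over `p`, then the induction hypothesis termwise
    have hsum : ((2 * (k + 1) : ℕ) : ℝ) * nPoint μ spinAt x ≤
        ∑ p : Fin (2 * k + 2), ∑ q : Fin (2 * k + 1),
          twoPoint μ spinAt (x p) (x (pairPerm p q 1)) * pairingSum (twoPoint μ spinAt) k (x ∘ pairRest p q) := by
      calc ((2 * (k + 1) : ℕ) : ℝ) * nPoint μ spinAt x
          = ∑ p : Fin (2 * k + 2), nPoint μ spinAt x := by
            rw [Finset.sum_const, Finset.card_univ, Fintype.card_fin, nsmul_eq_mul]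
            push_cast; ring
        _ ≤ ∑ p : Fin (2 * k + 2), ∑ q : Fin (2 * k + 1),
              twoPoint μ spinAt (x p) (x (pairPerm p q 1)) * nPoint μ spinAt (x ∘ pairRest p q) :=
            Finset.sum_le_sum fun p _ => nPoint_le_sum_twoPoint_mul_nPoint G hβ x p
        _ ≤ _ := Finset.sum_le_sum fun p _ => Finset.sum_le_sum fun q _ =>
            mul_le_mul_of_nonneg_left (ih (x ∘ pairRest p q)) (twoPoint_univ_free_nonneg G hβ _ _)
    rw [pairingSum_succ, ← div_eq_inv_mul, le_div_iff₀ hpos, mul_comm]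
    exact hsum

end FiniteGraph

/-! ### Part V. Transport to finite volumes of `ℤ^d`: discharge of the named fact -/

/-- The pairing functional only sees the values `S₂ (x i) (x j)`. [folklore] -/
theorem pairingSum_congr_of_eq {α α' : Type*} (S : α → α → ℝ) (S' : α' → α' → ℝ) (n : ℕ)
    (x : Fin (2 * n) → α) (x' : Fin (2 * n) → α') (h : ∀ i j, S (x i) (x j) = S' (x' i) (x' j)) :
    pairingSum S n x = pairingSum S' n x' := by
  unfold pairingSum
  congr 1
  refine Finset.sum_congr rfl fun τ _ => Finset.prod_congr rfl fun j _ => ?_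
  rw [h]

/-- **Discharge of `aizenman_nPoint_le_pairingSum_finite`** (the finite-volume lower half of
Aizenman's inequality, `HighDimTrivialityWick`, Part M): for a finite `Λ ⊂ ℤ^d`, free boundary
condition, zero field, `β ≥ 0`, `n ≥ 2` and `x₁,…,x_{2n} ∈ Λ`,
`⟨σ_{x₁} ⋯ σ_{x_{2n}}⟩_{Λ,β} ≤ 𝒢_n[⟨σσ⟩_{Λ,β}](x)`. The free measure in the volume `Λ` only
depends on the graph induced on `Λ` (`isingExpect_free_map`), to which the finite-graph
inequality `nPoint_le_pairingSum_univ_free` applies. [cite: AizenmanDuminilCopinAnnals2021, arXiv:1912.07973 §6.3, first display, lower inequality (p. 26), finite-volume form] -/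
theorem aizenman_nPoint_le_pairingSum_finite_holds : aizenman_nPoint_le_pairingSum_finite := by
  intro d Λ β hβ n _hn x hx
  classical
  -- the graph induced on `Λ`, on the vertex type `↥Λ`
  set ι : ↥Λ ↪ Site d := Function.Embedding.subtype (· ∈ Λ) with hι
  set GΛ : SimpleGraph ↥Λ := (zdGraph d).comap ι with hGΛ
  set x' : Fin (2 * n) → ↥Λ := fun i => ⟨x i, hx i⟩ with hx'
  have hmap : (univ : Finset ↥Λ).map ι = Λ := by
    rw [hι, Finset.univ_eq_attach, Finset.attach_map_val]
  have hadj : ∀ a ∈ (univ : Finset ↥Λ), ∀ b ∈ (univ : Finset ↥Λ),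
      ((zdGraph d).Adj (ι a) (ι b) ↔ GΛ.Adj a b) := fun _ _ _ _ => Iff.rfl
  -- transport of the expectations of spin monomials
  have hE : ∀ {m : ℕ} (y : Fin m → ↥Λ),
      nPoint (isingMeasure (zdGraph d) Λ β 0 .free) spinAt (fun i => (y i : Site d)) =
        nPoint (isingMeasure GΛ univ β 0 .free) spinAt y := by
    intro m y
    have key := isingExpect_free_map (G := GΛ) (G' := zdGraph d) ι (Λ := univ) hadj β 0
      (measurable_spinMonomial fun i => (y i : Site d))
    rw [hmap] at key
    change isingExpect (zdGraph d) Λ β 0 .free (spinMonomial fun i => (y i : Site d)) =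
      isingExpect GΛ univ β 0 .free (spinMonomial y)
    rw [key]
    congr 1
    funext σ
    simp only [spinMonomial]
    exact Finset.prod_congr rfl fun i _ => spinAt_extendAlong ι σ (y i)
  have hN : nPoint (isingMeasure (zdGraph d) Λ β 0 .free) spinAt x =
      nPoint (isingMeasure GΛ univ β 0 .free) spinAt x' := hE x'
  have h2 : ∀ i j, twoPoint (isingMeasure (zdGraph d) Λ β 0 .free) spinAt (x i) (x j) =
      twoPoint (isingMeasure GΛ univ β 0 .free) spinAt (x' i) (x' j) := by
    intro i j
    rw [twoPoint_eq_nPoint, twoPoint_eq_nPoint]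
    have := hE ![x' i, x' j]
    refine Eq.trans ?_ this
    congr 1
    funext l
    fin_cases l <;> rfl
  rw [hN, pairingSum_congr_of_eq _ _ n x x' h2]
  exact nPoint_le_pairingSum_univ_free GΛ hβ n x'

end Literature.Probability.LatticeModels

end
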